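import Mathlib
import Summits.ValiantsHypothesis.ValiantsHypothesis.Theses.ValuativeGCT
import Summits.ValiantsHypothesis.ValiantsHypothesis.Theorems.ValuativeGCTValuativeFlipIsotypicSliceTools
import Summits.ValiantsHypothesis.ValiantsHypothesis.Theorems.ValuativeGCTValuativeFlipStabInvLeExplicit
import Summits.ValiantsHypothesis.ValiantsHypothesis.Theorems.ValuativeGCTValuativeBound

/-!
# Isotypic slice bound, part 2: closed-form det-side census in the shape

Det side of crux `ValuativeGCT.ValuativeFlip` (stmt-ValiantsHypothesis-12624; wall-breaker axis
"det-orbit-closure multiplicity bounds for detCensus").  Every det-side bound landed so far for the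
crux is a TOTAL count over shapes with a bounded number of rows (`(mδ+1)^(2m²+m)` on `≤ 4` rows:
`stub_fourRowSliceBound`, `fourRowWeightBound`, `fourRow_detOrbitMultiplicity_le`; the Kronecker
majorant `g(λ, m×δ, m×δ)` of `stub_truncT0_le_kronecker` has no closed form).  This file gives the
first ISOTYPIC census in closed form, for EVERY shape:

* `sandHwsp_finrank_le_of_weight` — for `m ≥ 2`, any weight `χ` and any two row slots `j₀ ≠ j₁`,
  `dim (Hom_D ⊓ SAND ⊓ HWSP(χ)) ≤ (d j₁ + 1)^(m+1) · ∏_{j ∉ {j₀,j₁}} (d j + 1)^(m²)`, `d = (-χ)⁺`;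
* `isotypicSliceBound` — for `χ = λ*`: `dim (Hom_D ⊓ SAND ⊓ HWSP(λ*)) ≤ (λ₂+1)^(m+1) · ∏_{i≥3} (λ_i+1)^(m²)`
  (slot of `λ₁` normalised to a scalar, slot of `λ₂` to a companion matrix);
* `isotypic_truncT_finrank_le` — the same bound for every valuative truncation `T_U(λ)` of the crux
  (verbatim `let T`), uniformly in the centre `U` and the rank bound `r`;
* `isotypic_detOrbitMultiplicity_le` — `K_m(λ*) = mult_{λ*} ℂ[Δ(det_m)] ≤ (λ₂+1)^(m+1) · ∏_{i≥3} (λ_i+1)^(m²)`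
  (`ValuativeBound_proof` at `U = 0`); `isotypic_detOrbitMultiplicity_le_fourRow` — on `≤ 4`-row
  shapes `K_m(λ*) ≤ (λ₂+1)^(m+1) · ((λ₃+1)(λ₄+1))^(m²)`.

Reading for the crux.  The det side of a flip at `(n, m)` on a shape `λ` is bounded by a polynomial
in the parts `λ₂, λ₃, …` alone — of degree `m+1` in `λ₂` and `m²` in each further part — with NO
dependence on `λ₁` (which Kadish–Landsberg forces to be `≥ δ(m-n)` on the per side) nor on `δ`:
along every ray `(mδ - |λ̄|, λ̄)` the det census is bounded (ray stability made effective), and for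
shapes of growing length `k` the det capacity is `∏_{3 ≤ i ≤ k} (λ_i+1)^(m²)`, the quantity a
per-side certificate family in the tail (`stub_tailFlip`) has to beat.  Elementary over part 1 and
the landed `stub_stabInv_le_explicit`, `ValuativeBound_proof`; no named facts.
-/

set_option linter.dupNamespace false

namespace Summit.ValiantsHypothesis.ValiantsHypothesis.Theorems.ValuativeFlip

open MvPolynomial
open scoped BigOperators Matrix
open Literature.NumberTheory.DiophantineGeometry
open Literature.Computability.AlgebraicComplexity

noncomputable section

/-! ## The isotypic slice bound for a general weight -/

/-- **Isotypic slice bound, general weight** (`N = t + 2`, any two distinct row slots `j₀ ≠ j₁`).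
The degree-`D` polynomials on `End W` (`W = ℂ^{N×N}`, variables `X (j, i)`) invariant under the
row-wise unimodular sandwich `A_j ↦ P A_j Q` and `B`-semi-invariant of weight `χ` (the crux's Borel
clause) span a space of dimension at most
`(d j₁ + 1)^(N+1) · ∏_{j ∉ {j₀, j₁}} (d j + 1)^(N²)`, `d := (-χ)⁺` — INDEPENDENT of `D` and of the
weight `χ j₀` at the scalar slot. [folklore: Krylov normal form + torus weights] -/
theorem iso_finrank_le_of_weight (t : ℕ) {j₀ j₁ : MatIdx (t + 2)} (h01 : j₀ ≠ j₁)
    (χ : Weight (MatIdx (t + 2))) (D : ℕ) :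
    Module.finrank ℂ ↥(homogeneousSubmodule (MatIdx (t + 2) × MatIdx (t + 2)) ℂ D ⊓
        (⨅ (P : Matrix (Fin (t + 2)) (Fin (t + 2)) ℂ) (Q : Matrix (Fin (t + 2)) (Fin (t + 2)) ℂ)
          (_ : P.det = 1) (_ : Q.det = 1),
          LinearMap.ker ((aeval (sbSubst P Q)).toLinearMap - LinearMap.id)) ⊓
        (⨅ (g : Matrix.GeneralLinearGroup (MatIdx (t + 2)) ℂ) (_ : IsUpperTriangular g),
          LinearMap.ker ((MvPolynomial.aeval (R := ℂ) fun p : MatIdx (t + 2) × MatIdx (t + 2) =>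
              ∑ l : MatIdx (t + 2), ((g⁻¹ : Matrix.GeneralLinearGroup (MatIdx (t + 2)) ℂ) :
                Matrix (MatIdx (t + 2)) (MatIdx (t + 2)) ℂ) p.1 l •
                  (MvPolynomial.X (l, p.2) : MvPolynomial (MatIdx (t + 2) × MatIdx (t + 2)) ℂ)).toLinearMap -
            weightChar χ g • (LinearMap.id : MvPolynomial (MatIdx (t + 2) × MatIdx (t + 2)) ℂ →ₗ[ℂ]
              MvPolynomial (MatIdx (t + 2) × MatIdx (t + 2)) ℂ)))) ≤
      ((-χ j₁).toNat + 1) ^ (t + 3) *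
        ∏ j ∈ Finset.univ.filter (fun j : MatIdx (t + 2) => ¬(j = j₀ ∨ j = j₁)),
          ((-χ j).toNat + 1) ^ ((t + 2) * (t + 2)) := by
  classical
  have hprod := iso_prod_isoBound_eq t (Set.univ : Set (MatIdx (t + 2))) j₀ j₁ (-χ)
  have hfilter : (Finset.univ.filter fun j : MatIdx (t + 2) =>
      j ∈ (Set.univ : Set (MatIdx (t + 2))) ∧ ¬(j = j₀ ∨ j = j₁)) =
      Finset.univ.filter fun j : MatIdx (t + 2) => ¬(j = j₀ ∨ j = j₁) := by
    ext j
    simp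
  rw [hfilter] at hprod
  refine le_of_le_of_eq (iso_core t (S := Set.univ) h01 (Set.mem_univ j₀) (Set.mem_univ j₁) χ D _
    (inf_le_left.trans inf_le_left) (fun G hG P Q hP hQ => ?_) (fun G _ => ?_)
    (fun G hG g hg => ?_)) (hprod.trans ?_)
  · have h2 := (Submodule.mem_inf.mp (Submodule.mem_inf.mp hG).1).2
    simp only [Submodule.mem_iInf, LinearMap.mem_ker, LinearMap.sub_apply, sub_eq_zero] at h2
    exact h2 P Q hP hQ
  · rw [mem_supported]
    intro p _
    exact Set.mem_univ _
  · have h2 := (Submodule.mem_inf.mp hG).2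
    simp only [Submodule.mem_iInf, LinearMap.mem_ker, LinearMap.sub_apply, sub_eq_zero] at h2
    exact h2 g hg
  · rfl

/-- **Isotypic slice bound for a general weight, in the crux's conventions** (`m ≥ 2`, any two
distinct row slots `j₀ ≠ j₁ : MatIdx m`).  The degree-`D` row-wise unimodular sandwich invariants
on `End(ℂ^{m×m})` (the crux's explicit stabiliser clause) that are `B`-semi-invariant of weight `χ`
(the crux's Borel clause, verbatim) span a space of dimension at most
`(d j₁ + 1)^(m+1) · ∏_{j ∉ {j₀, j₁}} (d j + 1)^(m²)`, `d := (-χ)⁺`: independent of the degree `D`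
and of the weight at the slot `j₀`. [folklore: Krylov normal form + torus weights] -/
theorem sandHwsp_finrank_le_of_weight (m : ℕ) (hm : 2 ≤ m) (j₀ j₁ : MatIdx m) (h01 : j₀ ≠ j₁)
    (χ : Weight (MatIdx m)) (D : ℕ) :
    Module.finrank ℂ ↥(MvPolynomial.homogeneousSubmodule (MatIdx m × MatIdx m) ℂ D ⊓
        (⨅ (P : Matrix (Fin m) (Fin m) ℂ) (Q : Matrix (Fin m) (Fin m) ℂ) (_ : P.det = 1) (_ : Q.det = 1),
          LinearMap.ker ((MvPolynomial.aeval fun p : MatIdx m × MatIdx m =>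
            ∑ l : MatIdx m, (P (ofLex p.2).1 (ofLex l).1 * Q (ofLex l).2 (ofLex p.2).2) •
              (MvPolynomial.X (p.1, l) : MvPolynomial (MatIdx m × MatIdx m) ℂ)).toLinearMap -
            (LinearMap.id : MvPolynomial (MatIdx m × MatIdx m) ℂ →ₗ[ℂ] MvPolynomial (MatIdx m × MatIdx m) ℂ))) ⊓
        (⨅ (g : Matrix.GeneralLinearGroup (MatIdx m) ℂ) (_ : IsUpperTriangular g),
          LinearMap.ker ((MvPolynomial.aeval fun p : MatIdx m × MatIdx m =>
            ∑ l : MatIdx m, ((g⁻¹ : Matrix.GeneralLinearGroup (MatIdx m) ℂ) : Matrix (MatIdx m) (MatIdx m) ℂ) p.1 l •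
              (MvPolynomial.X (l, p.2) : MvPolynomial (MatIdx m × MatIdx m) ℂ)).toLinearMap -
            weightChar χ g • (LinearMap.id : MvPolynomial (MatIdx m × MatIdx m) ℂ →ₗ[ℂ]
              MvPolynomial (MatIdx m × MatIdx m) ℂ)))) ≤
      ((-χ j₁).toNat + 1) ^ (m + 1) *
        ∏ j ∈ Finset.univ.filter (fun j : MatIdx m => ¬(j = j₀ ∨ j = j₁)), ((-χ j).toNat + 1) ^ (m * m) := by
  obtain ⟨t, rfl⟩ : ∃ t, m = t + 2 := ⟨m - 2, by omega⟩
  exact iso_finrank_le_of_weight t h01 χ D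

/-! ## Partition weights: the bound in terms of the parts `λ₂, λ₃, …` -/

/-- Reading the transported dual weight `λ* = (dualOfPartition (m·m) λ).toMatIdx` at the slot of
row-major index `i`: `-λ*(slot i) = λ_{m² - i}` (the `(m² - 1 - i)`-th sorted part, `0`-indexed).
[folklore] -/
theorem neg_toMatIdx_dualOfPartition_toNat (m : ℕ) {d : ℕ} (lam : Nat.Partition d) (i : Fin (m * m)) :
    (-(((Weight.dualOfPartition (m * m) lam).toMatIdx : Weight (MatIdx m)) (matIdxEquiv m i))).toNat =
      lam.sortedParts.getD (m * m - 1 - i) 0 := by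
  unfold Weight.toMatIdx
  rw [OrderIso.symm_apply_apply, Weight.dualOfPartition, Weight.dual, Weight.ofPartition_apply, neg_neg,
    Int.toNat_natCast, Fin.val_rev]
  congr 1
  omega

/-- **ISOTYPIC SLICE BOUND** (det side of crux `ValuativeGCT.ValuativeFlip`, closed form in the shape).
For `m ≥ 2`, every degree `D` and every partition `λ` (parts `λ₁ ≥ λ₂ ≥ …`, any number of them),
the degree-`D` row-wise unimodular sandwich invariants on `End(ℂ^{m×m})` that are
`B`-semi-invariant of weight `λ* = (dualOfPartition (m·m) λ).toMatIdx` — the det-side multiplicity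
space `Hom_D ⊓ SAND ⊓ HWSP(λ*)` of the crux, which contains every valuative truncation `T_U(λ)` —
span a space of dimension at most
`(λ₂ + 1)^(m+1) · ∏_{i ≥ 3} (λ_i + 1)^(m²)`  (written with `0`-indexed sorted parts
`λ_{i+1} = sortedParts.getD i 0` over `2 ≤ i < m²`).  The bound does NOT involve `λ₁` or `D`:
normalise the slot of `λ₁` to a scalar and the slot of `λ₂` to a companion matrix
(`SL_m × SL_m`-density of the Krylov slice), and count slice monomials of the prescribed row
degrees (semi-invariants are multihomogeneous in the row slots).  Compare the landed total count
`(mδ+1)^(2m²+m)` on `≤ 4`-row shapes (`fourRowWeightBound`). [folklore: Krylov normal form + torus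
weights; this crux's det census] -/
theorem isotypicSliceBound (m : ℕ) (hm : 2 ≤ m) (D : ℕ) {d : ℕ} (lam : Nat.Partition d) :
    Module.finrank ℂ ↥(MvPolynomial.homogeneousSubmodule (MatIdx m × MatIdx m) ℂ D ⊓
        (⨅ (P : Matrix (Fin m) (Fin m) ℂ) (Q : Matrix (Fin m) (Fin m) ℂ) (_ : P.det = 1) (_ : Q.det = 1),
          LinearMap.ker ((MvPolynomial.aeval fun p : MatIdx m × MatIdx m =>
            ∑ l : MatIdx m, (P (ofLex p.2).1 (ofLex l).1 * Q (ofLex l).2 (ofLex p.2).2) •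
              (MvPolynomial.X (p.1, l) : MvPolynomial (MatIdx m × MatIdx m) ℂ)).toLinearMap -
            (LinearMap.id : MvPolynomial (MatIdx m × MatIdx m) ℂ →ₗ[ℂ] MvPolynomial (MatIdx m × MatIdx m) ℂ))) ⊓
        (⨅ (g : Matrix.GeneralLinearGroup (MatIdx m) ℂ) (_ : IsUpperTriangular g),
          LinearMap.ker ((MvPolynomial.aeval fun p : MatIdx m × MatIdx m =>
            ∑ l : MatIdx m, ((g⁻¹ : Matrix.GeneralLinearGroup (MatIdx m) ℂ) : Matrix (MatIdx m) (MatIdx m) ℂ) p.1 l •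
              (MvPolynomial.X (l, p.2) : MvPolynomial (MatIdx m × MatIdx m) ℂ)).toLinearMap -
            weightChar ((Weight.dualOfPartition (m * m) lam).toMatIdx : Weight (MatIdx m)) g •
              (LinearMap.id : MvPolynomial (MatIdx m × MatIdx m) ℂ →ₗ[ℂ] MvPolynomial (MatIdx m × MatIdx m) ℂ)))) ≤
      (lam.sortedParts.getD 1 0 + 1) ^ (m + 1) *
        ∏ i ∈ Finset.Ico 2 (m * m), (lam.sortedParts.getD i 0 + 1) ^ (m * m) := by
  have hmm : 4 ≤ m * m := by nlinarith
  set e := matIdxEquiv m with he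
  set a : Fin (m * m) := ⟨m * m - 1, by omega⟩ with ha
  set b : Fin (m * m) := ⟨m * m - 2, by omega⟩ with hb
  have hab : a ≠ b := fun h => by
    have := congrArg Fin.val h
    simp only [ha, hb] at this
    omega
  have h01 : e a ≠ e b := fun h => hab (e.injective h)
  set χ := ((Weight.dualOfPartition (m * m) lam).toMatIdx : Weight (MatIdx m)) with hχ
  have hval : ∀ i : Fin (m * m), (-χ (e i)).toNat = lam.sortedParts.getD (m * m - 1 - i) 0 :=
    fun i => neg_toMatIdx_dualOfPartition_toNat m lam i
  refine (sandHwsp_finrank_le_of_weight m hm (e a) (e b) h01 χ D).trans (le_of_eq ?_)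
  have hidx : m * m - 1 - ((b : Fin (m * m)) : ℕ) = 1 := by
    simp only [hb, Fin.val_mk]
    omega
  congr 1
  · rw [hval b, hidx]
  · -- reindex the product over the slots `j ∉ {e a, e b}` by the part index `i = m² - 1 - idx j`
    set G : ℕ → ℕ := fun i => (lam.sortedParts.getD i 0 + 1) ^ (m * m) with hG
    set F : ℕ → ℕ := fun i => if 2 ≤ i then G i else 1 with hF
    have h1 : ∏ j ∈ Finset.univ.filter (fun j : MatIdx m => ¬(j = e a ∨ j = e b)),
        ((-χ j).toNat + 1) ^ (m * m) =
        ∏ j : MatIdx m, (if ¬(j = e a ∨ j = e b) then ((-χ j).toNat + 1) ^ (m * m) else 1) := by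
      rw [Finset.prod_filter]
    have h2 : ∏ j : MatIdx m, (if ¬(j = e a ∨ j = e b) then ((-χ j).toNat + 1) ^ (m * m) else 1) =
        ∏ i : Fin (m * m), F (m * m - 1 - (i : ℕ)) := by
      refine (Fintype.prod_equiv e.toEquiv (fun i : Fin (m * m) => F (m * m - 1 - (i : ℕ)))
        (fun j => if ¬(j = e a ∨ j = e b) then ((-χ j).toNat + 1) ^ (m * m) else 1) fun i => ?_).symm
      have hi : (i = a ∨ i = b) ↔ (e i = e a ∨ e i = e b) := by
        rw [e.injective.eq_iff, e.injective.eq_iff]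
      show F (m * m - 1 - (i : ℕ)) =
        if ¬(e i = e a ∨ e i = e b) then ((-χ (e i)).toNat + 1) ^ (m * m) else 1
      have hcond : (2 ≤ m * m - 1 - (i : ℕ)) ↔ ¬(e i = e a ∨ e i = e b) := by
        rw [← hi, Fin.ext_iff, Fin.ext_iff]
        simp only [ha, hb, Fin.val_mk]
        have := i.2
        omega
      rw [hF]
      dsimp only
      rw [hval i]
      by_cases hc : 2 ≤ m * m - 1 - (i : ℕ)
      · rw [if_pos hc, if_pos (hcond.mp hc)]
      · rw [if_neg hc, if_neg (fun h => hc (hcond.mpr h))]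
    have h3 : ∏ i : Fin (m * m), F (m * m - 1 - (i : ℕ)) = ∏ i ∈ Finset.range (m * m), F i := by
      rw [Fin.prod_univ_eq_prod_range (fun i => F (m * m - 1 - i)) (m * m), Finset.prod_range_reflect]
    have h4 : ∏ i ∈ Finset.range (m * m), F i = ∏ i ∈ Finset.Ico 2 (m * m), G i := by
      rw [hF, ← Finset.prod_filter]
      congr 1
      ext i
      simp only [Finset.mem_filter, Finset.mem_range, Finset.mem_Ico]
      omega
    rw [h1, h2, h3, h4]

/-! ## The bound in the crux's currencies: valuative truncations and `K_m(λ*)` -/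

/-- **Isotypic bound for every valuative truncation.**  For `m ≥ 2`, every centre `U`, rank bound
`r`, degree `δ` and partition `λ ⊢ mδ`, the crux's truncation
`T_U(λ) = Hom_{mδ} ⊓ I(L_U)^{δ(m-r)} ⊓ STAB(det_m) ⊓ HWSP(λ*)` (verbatim the `let T` of
`ValuativeGCT.ValuativeFlip`) has dimension at most `(λ₂ + 1)^(m+1) · ∏_{i ≥ 3} (λ_i + 1)^(m²)`:
drop the ideal power, `STAB ≤ SAND` (`stub_stabInv_le_explicit`), and `isotypicSliceBound`.
So the det side of a valuative flip is polynomially bounded in the parts `λ₂, λ₃, …` ALONE,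
uniformly in the first part `λ₁ ≥ δ(m-n)` that Kadish–Landsberg forces on the per side.
[this crux's det census; folklore] -/
theorem isotypic_truncT_finrank_le (m : ℕ) (hm : 2 ≤ m) (U : Submodule ℂ (MatIdx m → ℂ)) (r δ : ℕ)
    (lam : Nat.Partition (m * δ)) :
    Module.finrank ℂ ↥(MvPolynomial.homogeneousSubmodule (MatIdx m × MatIdx m) ℂ (m * δ) ⊓
        ((MvPolynomial.vanishingIdeal ℂ {p : MatIdx m × MatIdx m → ℂ | ∀ j : MatIdx m, (fun i => p (j, i)) ∈ U}) ^
            (δ * (m - r))).restrictScalars ℂ ⊓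
        (⨅ (M : Matrix (MatIdx m) (MatIdx m) ℂ) (_ : linSubst (MatIdx m) ℂ M (detFormLex ℂ m) = detFormLex ℂ m),
          LinearMap.ker ((MvPolynomial.aeval (R := ℂ) fun p : MatIdx m × MatIdx m =>
              ∑ l : MatIdx m, M l p.2 • MvPolynomial.X (p.1, l)).toLinearMap -
            LinearMap.id (R := ℂ) (M := MvPolynomial (MatIdx m × MatIdx m) ℂ))) ⊓
        (⨅ (g : Matrix.GeneralLinearGroup (MatIdx m) ℂ) (_ : IsUpperTriangular g),
          LinearMap.ker ((MvPolynomial.aeval (R := ℂ) fun p : MatIdx m × MatIdx m =>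
              ∑ l : MatIdx m, ((g⁻¹ : Matrix.GeneralLinearGroup (MatIdx m) ℂ) : Matrix (MatIdx m) (MatIdx m) ℂ) p.1 l •
                MvPolynomial.X (l, p.2)).toLinearMap -
            weightChar ((Weight.dualOfPartition (m * m) lam).toMatIdx : Weight (MatIdx m)) g •
              LinearMap.id (R := ℂ) (M := MvPolynomial (MatIdx m × MatIdx m) ℂ)))) ≤
      (lam.sortedParts.getD 1 0 + 1) ^ (m + 1) *
        ∏ i ∈ Finset.Ico 2 (m * m), (lam.sortedParts.getD i 0 + 1) ^ (m * m) := by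
  haveI : Module.Finite ℂ ↥(MvPolynomial.homogeneousSubmodule (MatIdx m × MatIdx m) ℂ (m * δ)) :=
    Module.Finite.iff_fg.mpr (MvPolynomial.homogeneousSubmodule_fg (MatIdx m × MatIdx m) ℂ (m * δ))
  haveI : Module.Finite ℂ ↥(MvPolynomial.homogeneousSubmodule (MatIdx m × MatIdx m) ℂ (m * δ) ⊓
        (⨅ (P : Matrix (Fin m) (Fin m) ℂ) (Q : Matrix (Fin m) (Fin m) ℂ) (_ : P.det = 1) (_ : Q.det = 1),
          LinearMap.ker ((MvPolynomial.aeval fun p : MatIdx m × MatIdx m =>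
            ∑ l : MatIdx m, (P (ofLex p.2).1 (ofLex l).1 * Q (ofLex l).2 (ofLex p.2).2) •
              (MvPolynomial.X (p.1, l) : MvPolynomial (MatIdx m × MatIdx m) ℂ)).toLinearMap -
            (LinearMap.id : MvPolynomial (MatIdx m × MatIdx m) ℂ →ₗ[ℂ] MvPolynomial (MatIdx m × MatIdx m) ℂ))) ⊓
        (⨅ (g : Matrix.GeneralLinearGroup (MatIdx m) ℂ) (_ : IsUpperTriangular g),
          LinearMap.ker ((MvPolynomial.aeval fun p : MatIdx m × MatIdx m =>
            ∑ l : MatIdx m, ((g⁻¹ : Matrix.GeneralLinearGroup (MatIdx m) ℂ) : Matrix (MatIdx m) (MatIdx m) ℂ) p.1 l •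
              (MvPolynomial.X (l, p.2) : MvPolynomial (MatIdx m × MatIdx m) ℂ)).toLinearMap -
            weightChar ((Weight.dualOfPartition (m * m) lam).toMatIdx : Weight (MatIdx m)) g •
              (LinearMap.id : MvPolynomial (MatIdx m × MatIdx m) ℂ →ₗ[ℂ] MvPolynomial (MatIdx m × MatIdx m) ℂ)))) :=
    Submodule.finiteDimensional_of_le (inf_le_left.trans inf_le_left)
  refine (Submodule.finrank_mono ?_).trans (isotypicSliceBound m hm (m * δ) lam)
  exact le_inf (le_inf (inf_le_left.trans (inf_le_left.trans inf_le_left))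
    ((inf_le_left.trans inf_le_right).trans ((stub_stabInv_le_explicit m).trans inf_le_left))) inf_le_right

/-- **Isotypic det-orbit-closure multiplicity bound.**  For `m ≥ 2`, every degree `δ` and every
`λ ⊢ mδ` with at most `m²` parts, the multiplicity of the dual weight `λ*` in the coordinate ring of
the orbit closure of `det_m` satisfies
`K_m(λ*) = mult_{λ*} ℂ[Δ(det_m)] ≤ (λ₂ + 1)^(m+1) · ∏_{i ≥ 3} (λ_i + 1)^(m²)`
(`0`-indexed sorted parts `getD i`, `2 ≤ i < m²`): `K_m(λ*) ≤ dim T_⊥(λ)` by the route's valuative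
bound (`ValuativeBound_proof`, BLMW 2011 Prop. 5.2.1 at `U = 0`) and `isotypic_truncT_finrank_le`.
A closed-form ISOTYPIC det census: independent of `λ₁` and of `δ`, polynomial of degree `m + 1` in
`λ₂` and `m²` in each further part — against the total counts `(mδ+1)^((k-2)m²+m)` on `≤ k`-row
shapes landed before. [this crux's det census; BLMW 2011 §5.2] -/
theorem isotypic_detOrbitMultiplicity_le : ∀ (m : ℕ) [NeZero m], 2 ≤ m → ∀ (δ : ℕ) (lam : Nat.Partition (m * δ)), lam.parts.card ≤ m * m → orbitMultiplicity ℂ (detFormLex ℂ m) m ((Weight.dualOfPartition (m * m) lam).toMatIdx : Weight (MatIdx m)) ≤ (lam.sortedParts.getD 1 0 + 1) ^ (m + 1) * ∏ i ∈ Finset.Ico 2 (m * m), (lam.sortedParts.getD i 0 + 1) ^ (m * m) := by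
  intro m _ hm δ lam hlam
  have hU : ∀ u ∈ (⊥ : Submodule ℂ (MatIdx m → ℂ)), (Matrix.of fun a b : Fin m => u (toLex (a, b))).rank ≤ 0 := by
    intro u hu
    rw [Submodule.mem_bot] at hu
    subst hu
    have h0 : (Matrix.of fun a b : Fin m => (0 : MatIdx m → ℂ) (toLex (a, b))) = 0 := by
      ext a b
      simp
    rw [h0, Matrix.rank_zero]
  exact (Summit.ValiantsHypothesis.ValiantsHypothesis.Theorems.ValuativeBound.ValuativeBound_proof
    m ⊥ 0 hU δ lam hlam).trans (isotypic_truncT_finrank_le m hm ⊥ 0 δ lam)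

/-- **Four-row reading.**  For `m ≥ 2` and `λ ⊢ mδ` with at most four parts `λ₁ ≥ λ₂ ≥ λ₃ ≥ λ₄ ≥ 0`,
`K_m(λ*) ≤ (λ₂ + 1)^(m+1) · ((λ₃ + 1) · (λ₄ + 1))^(m²)` — the isotypic refinement of the landed
four-row total count `K_m(λ*) ≤ (mδ + 1)^(2m² + m)` (`fourRow_detOrbitMultiplicity_le`).
[this crux's det census] -/
theorem isotypic_detOrbitMultiplicity_le_fourRow (m : ℕ) [NeZero m] (hm : 2 ≤ m) (δ : ℕ)
    (lam : Nat.Partition (m * δ)) (hlam : lam.parts.card ≤ 4) :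
    orbitMultiplicity ℂ (detFormLex ℂ m) m ((Weight.dualOfPartition (m * m) lam).toMatIdx : Weight (MatIdx m)) ≤
      (lam.sortedParts.getD 1 0 + 1) ^ (m + 1) *
        ((lam.sortedParts.getD 2 0 + 1) * (lam.sortedParts.getD 3 0 + 1)) ^ (m * m) := by
  have hmm : 4 ≤ m * m := by nlinarith
  refine (isotypic_detOrbitMultiplicity_le m hm δ lam (hlam.trans hmm)).trans (le_of_eq ?_)
  congr 1
  have hlen : lam.sortedParts.length ≤ 4 := by
    rw [Nat.Partition.length_sortedParts]
    exact hlam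
  have hsplit : Finset.Ico 2 (m * m) = {2, 3} ∪ Finset.Ico 4 (m * m) := by
    ext i
    simp only [Finset.mem_Ico, Finset.mem_union, Finset.mem_insert, Finset.mem_singleton]
    omega
  have hdisj : Disjoint ({2, 3} : Finset ℕ) (Finset.Ico 4 (m * m)) := by
    rw [Finset.disjoint_left]
    intro i hi hi'
    simp only [Finset.mem_insert, Finset.mem_singleton] at hi
    rw [Finset.mem_Ico] at hi'
    omega
  have htail : ∏ i ∈ Finset.Ico 4 (m * m), (lam.sortedParts.getD i 0 + 1) ^ (m * m) = 1 := by
    refine Finset.prod_eq_one fun i hi => ?_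
    rw [Finset.mem_Ico] at hi
    rw [List.getD_eq_default _ _ (by omega)]
    simp
  rw [hsplit, Finset.prod_union hdisj, htail, mul_one, Finset.prod_pair (by norm_num), mul_pow]

/-! ## The crux reduced to a per-side statement with an explicit threshold -/

/-- **`ValuativeFlip` from isotypic certificates.**  The crux `ValuativeGCT.ValuativeFlip` follows
(with the no-cut centre `U = ⊥`, `r = 0`) from a purely PER-SIDE statement with an explicit numeric
threshold: for every `c`, eventually in `n`, at every window position `n ≤ m ≤ 2^((log₂ n + c)^c)`
some shape `λ ⊢ mδ` (`≤ m²` parts) has padded-permanent multiplicity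
`mult_{λ*} ℂ[Δ_m(X₀₀^{m-n} per_n)] > (λ₂ + 1)^(m+1) · ∏_{i ≥ 3} (λ_i + 1)^(m²)`.
(Composition of `isotypic_truncT_finrank_le` with the crux body; the threshold is the isotypic det
census, so the residual difficulty of the crux is per-side only, shape by shape.)
[this crux; reduction] -/
theorem valuativeFlip_of_isotypicCertificates
    (h : ∀ c : ℕ, ∃ n₀ : ℕ, ∀ n ≥ n₀, ∀ (m : ℕ) [NeZero m], n ≤ m → m ≤ 2 ^ ((Nat.log 2 n + c) ^ c) →
      ∃ (δ : ℕ) (lam : Nat.Partition (m * δ)), lam.parts.card ≤ m * m ∧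
        (lam.sortedParts.getD 1 0 + 1) ^ (m + 1) *
            ∏ i ∈ Finset.Ico 2 (m * m), (lam.sortedParts.getD i 0 + 1) ^ (m * m) <
          orbitMultiplicity ℂ (paddedPerFormLex ℂ n m) m
            ((Weight.dualOfPartition (m * m) lam).toMatIdx : Weight (MatIdx m))) :
    Summit.ValiantsHypothesis.ValiantsHypothesis.Theses.ValuativeGCT.ValuativeFlip := by
  intro c
  obtain ⟨n₀, hn₀⟩ := h c
  refine ⟨max n₀ 2, fun n hn m _ hnm hm => ?_⟩
  have hm2 : 2 ≤ m := le_trans (le_of_max_le_right hn) hnm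
  obtain ⟨δ, lam, hcard, hlt⟩ := hn₀ n (le_of_max_le_left hn) m hnm hm
  refine ⟨⊥, 0, δ, lam, ?_, hcard, ?_⟩
  · intro u hu
    rw [Submodule.mem_bot] at hu
    subst hu
    have h0 : (Matrix.of fun a b : Fin m => (0 : MatIdx m → ℂ) (toLex (a, b))) = 0 := by
      ext a b
      simp
    rw [h0, Matrix.rank_zero]
  · intro χ T
    exact lt_of_le_of_lt (isotypic_truncT_finrank_le m hm2 ⊥ 0 δ lam) hlt

/-- **Mulmuley–Sohoni obstruction from an isotypic certificate** (one position).  For `m ≥ 2`, a shape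
`λ ⊢ mδ` (`≤ m²` parts) whose padded-permanent multiplicity exceeds the isotypic det census,
`mult_{λ*} ℂ[Δ_m(X₀₀^{m-n} per_n)] > (λ₂ + 1)^(m+1) · ∏_{i ≥ 3} (λ_i + 1)^(m²)`, is a multiplicity
obstruction `K_m(λ*) < mult_{λ*} ℂ[Δ_m(X₀₀^{m-n} per_n)]` (hence `X₀₀^{m-n} per_n ∉ Δ(det_m)` by the
landed `GctMultPrinciple`). [this crux; Mulmuley–Sohoni 2001 §4] -/
theorem detOrbitMultiplicity_lt_of_isotypicCertificate (n m : ℕ) [NeZero m] (hm : 2 ≤ m) (δ : ℕ)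
    (lam : Nat.Partition (m * δ)) (hcard : lam.parts.card ≤ m * m)
    (hlt : (lam.sortedParts.getD 1 0 + 1) ^ (m + 1) *
        ∏ i ∈ Finset.Ico 2 (m * m), (lam.sortedParts.getD i 0 + 1) ^ (m * m) <
      orbitMultiplicity ℂ (paddedPerFormLex ℂ n m) m
        ((Weight.dualOfPartition (m * m) lam).toMatIdx : Weight (MatIdx m))) :
    orbitMultiplicity ℂ (detFormLex ℂ m) m ((Weight.dualOfPartition (m * m) lam).toMatIdx : Weight (MatIdx m)) <
      orbitMultiplicity ℂ (paddedPerFormLex ℂ n m) m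
        ((Weight.dualOfPartition (m * m) lam).toMatIdx : Weight (MatIdx m)) :=
  lt_of_le_of_lt (isotypic_detOrbitMultiplicity_le m hm δ lam hcard) hlt

end

end Summit.ValiantsHypothesis.ValiantsHypothesis.Theorems.ValuativeFlip
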